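import Mathlib
import Summits.KontsevichZagierPeriods.Zeta5Search.DenomLaw.PathAccountingShallow

/-!
# ζ(5) search — DENOM-LAW D1: two bounds on the path weight `C⋆` and the PATH node at `⌊d/p⌋ = 1` from RULE R1's value

Cell `pub-zeta5`, track DENOM-LAW (denom-prover-d1 g7, 2026-08-24; ATTEMPT-8 §12).  HONEST FRAMING: systematic search; MODEL/structure side —
elementary counting on Hamiltonian paths of `K₇` (no p-adics); nothing about ζ(5); no γ; no irrationality claim; records in print UNMOVED.

## What is proved (kernel-checked)
* `pathWeight_le_eleven`, `cStar_le_eleven` — a path has five interior vertices and six edges: `C⋆ ≤ 11` (sharper than `C⋆ ≤ a + 6` for `a ≥ 6`).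
* `pathWeight_le_five_of_isolated`, `cStar_le_five_of_isolated` — if parameter `1` is the only one reaching `p` and every pair block through
  parameter `1` lies below `p` (e.g. every `a = 1` type with the pair block `(1,7)` below `p`), then `C⋆ ≤ 5`: in a path the vertex `1` is
  either an end (then no interior vertex reaches `p` and at most five edges avoid it) or interior (one heavy vertex, two light edges).
* `cStar_le_five_of_sorted` — the b-form: sorted, `b₂ < p`, pair block `(1,7)` below `p` ⇒ `C⋆ ≤ 5`.
* `pathAccounting_of_value_one` — at `⌊d/p⌋ = 1`, `C⋆ ≤ a + 5` and RULE R1's value `(a + 1) − N ≤ v` give the PATH node's conclusion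
  `⌊d/p⌋ − N − min([⌊d/p⌋ ≥ 2], 5 − C⋆) ≤ v`.
-/

namespace Summit.KontsevichZagierPeriods.Zeta5Search.DenomLaw.FirstPeriodKit

open Finset
open Summit.KontsevichZagierPeriods.Zeta5Search.CasoratianValuation (pairFloors)
open Summit.KontsevichZagierPeriods.Zeta5Search.WedgeDictionary (dOf)
open Summit.KontsevichZagierPeriods.Zeta5Search.DenomLaw (Sorted7 BlockGe longCount pathWeight cStar)

variable {b : ℕ → ℤ} {p : ℕ}

/-- **a Hamiltonian path weighs at most `11`**: five interior vertices, six edges. -/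
theorem pathWeight_le_eleven (b : ℕ → ℤ) (p : ℕ) (π : Equiv.Perm (Fin 7)) : pathWeight b p π ≤ 11 := by
  unfold pathWeight
  exact le_trans (add_le_add (Finset.card_filter_le _ _) (Finset.card_filter_le _ _)) (by simp)

/-- **`C⋆ ≤ 11`.** -/
theorem cStar_le_eleven (b : ℕ → ℤ) (p : ℕ) : cStar b p ≤ 11 :=
  Finset.sup_le fun π _ => pathWeight_le_eleven b p π

/-- **an isolated heavy vertex**: if parameter `1` is the only parameter reaching `p` and every pair block through it lies below `p`, every
Hamiltonian path weighs at most `5`. -/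
theorem pathWeight_le_five_of_isolated (hlong : ∀ i : Fin 7, (p : ℤ) ≤ b (i.val + 1) → i.val = 0)
    (hlow : ∀ k : Fin 7, k.val ≠ 0 → b 0 - b 1 - b (k.val + 1) < (p : ℤ)) (π : Equiv.Perm (Fin 7)) :
    pathWeight b p π ≤ 5 := by
  unfold pathWeight
  set s : Fin 7 := π.symm 0 with hs
  have hπs : π s = 0 := by rw [hs]; simp
  have key : ∀ j : Fin 7, (π j).val = 0 → j = s := by
    intro j h
    have h' : π j = π s := by rw [hπs]; exact Fin.ext h
    exact π.injective h'
  -- the interior heavy vertices: only vertex `1`, at most once, and only if it is interior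
  set S1 := (Finset.univ : Finset (Fin 5)).filter fun t => (p : ℤ) ≤ b ((π ⟨t.val + 1, by omega⟩).val + 1) with hS1
  set S2 := (Finset.univ : Finset (Fin 6)).filter fun t =>
      (p : ℤ) ≤ b 0 - b ((π ⟨t.val, by omega⟩).val + 1) - b ((π ⟨t.val + 1, by omega⟩).val + 1) with hS2
  have mem1 : ∀ t ∈ S1, t.val + 1 = s.val := by
    intro t ht
    rw [hS1, Finset.mem_filter] at ht
    have h0 := hlong _ ht.2
    have := key _ h0
    rw [← this]
  have c1 : S1.card ≤ 1 := by
    refine Finset.card_le_one.2 fun a ha c hc => ?_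
    have h1 := mem1 a ha; have h2 := mem1 c hc
    exact Fin.ext (by omega)
  have c1' : s.val = 0 ∨ s.val = 6 → S1.card = 0 := by
    intro h6
    rw [Finset.card_eq_zero, Finset.eq_empty_iff_forall_notMem]
    intro t ht
    have := mem1 t ht
    have := t.isLt
    omega
  -- the heavy edges avoid the vertex `1`
  have mem2 : ∀ t ∈ S2, t.val ≠ s.val ∧ t.val + 1 ≠ s.val := by
    intro t ht
    rw [hS2, Finset.mem_filter] at ht
    obtain ⟨-, hge⟩ := ht
    have hne : (⟨t.val, by omega⟩ : Fin 7) ≠ ⟨t.val + 1, by omega⟩ := by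
      intro h; have := congrArg Fin.val h; simp at this
    constructor
    · intro h
      have e1 : (⟨t.val, by omega⟩ : Fin 7) = s := Fin.ext h
      have hv : (π ⟨t.val, by omega⟩).val = 0 := by rw [e1, hπs]; rfl
      have hk : (π ⟨t.val + 1, by omega⟩).val ≠ 0 := by
        intro h0
        have := key _ h0
        exact hne (e1.trans this.symm)
      have := hlow _ hk
      rw [hv] at hge
      linarith
    · intro h
      have e1 : (⟨t.val + 1, by omega⟩ : Fin 7) = s := Fin.ext h
      have hv : (π ⟨t.val + 1, by omega⟩).val = 0 := by rw [e1, hπs]; rfl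
      have hk : (π ⟨t.val, by omega⟩).val ≠ 0 := by
        intro h0
        have := key _ h0
        exact hne (this.trans e1.symm)
      have := hlow _ hk
      rw [hv] at hge
      linarith
  have sub2 : S2 ⊆ (Finset.univ : Finset (Fin 6)).filter fun t => t.val ≠ s.val ∧ t.val + 1 ≠ s.val := by
    intro t ht
    exact Finset.mem_filter.2 ⟨Finset.mem_univ _, mem2 t ht⟩
  have c2 := Finset.card_le_card sub2
  -- count by the position of the vertex `1`
  have hs7 := s.isLt
  obtain ⟨n, hn⟩ : ∃ n : ℕ, s.val = n := ⟨_, rfl⟩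
  rw [hn] at c2 c1' hs7
  interval_cases n
  · rw [c1' (Or.inl rfl), Nat.zero_add]
    exact le_trans c2 (by decide)
  · exact le_trans (add_le_add c1 c2) (by decide)
  · exact le_trans (add_le_add c1 c2) (by decide)
  · exact le_trans (add_le_add c1 c2) (by decide)
  · exact le_trans (add_le_add c1 c2) (by decide)
  · exact le_trans (add_le_add c1 c2) (by decide)
  · rw [c1' (Or.inr rfl), Nat.zero_add]
    exact le_trans c2 (by decide)

/-- **`C⋆ ≤ 5` for an isolated heavy vertex.** -/
theorem cStar_le_five_of_isolated (hlong : ∀ i : Fin 7, (p : ℤ) ≤ b (i.val + 1) → i.val = 0)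
    (hlow : ∀ k : Fin 7, k.val ≠ 0 → b 0 - b 1 - b (k.val + 1) < (p : ℤ)) : cStar b p ≤ 5 :=
  Finset.sup_le fun π _ => pathWeight_le_five_of_isolated hlong hlow π


/-- on a sorted vector with `b₂ < p` only parameter `1` can reach `p`. -/
theorem isolated_of_sorted (hs : Sorted7 b) (h2 : b 2 < (p : ℤ)) : ∀ i : Fin 7, (p : ℤ) ≤ b (i.val + 1) → i.val = 0 := by
  obtain ⟨s2, s3, s4, s5, s6, s7⟩ := sorted7_chain hs
  intro i hi
  fin_cases i <;> simp at hi ⊢ <;> linarith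

/-- on a sorted vector with the pair block `(1,7)` below `p` every pair block through parameter `1` lies below `p`. -/
theorem lowThroughOne_of_sorted (hs : Sorted7 b) (h17 : ¬ BlockGe b p 1 7) :
    ∀ k : Fin 7, k.val ≠ 0 → b 0 - b 1 - b (k.val + 1) < (p : ℤ) := by
  obtain ⟨s2, s3, s4, s5, s6, s7⟩ := sorted7_chain hs
  have h17' := not_le.1 h17
  intro k hk
  fin_cases k <;> simp at hk ⊢ <;> linarith

/-- **`C⋆ ≤ 5` on every sorted cell with `b₂ < p` and the pair block `(1,7)` below `p`** (all `a ≤ 1` digit types with `λ₁ = 6`). -/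
theorem cStar_le_five_of_sorted (hs : Sorted7 b) (h2 : b 2 < (p : ℤ)) (h17 : ¬ BlockGe b p 1 7) : cStar b p ≤ 5 :=
  cStar_le_five_of_isolated (isolated_of_sorted hs h2) (lowThroughOne_of_sorted hs h17)

/-- **the PATH node at `⌊d/p⌋ = 1` from RULE R1's value**: `C⋆ ≤ a + 5` and `(a + 1) − N ≤ v` give
`⌊d/p⌋ − N − min([⌊d/p⌋ ≥ 2], 5 − C⋆) ≤ v`. -/
theorem pathAccounting_of_value_one (hfd : dOf b / (p : ℤ) = 1) (hC : (cStar b p : ℤ) ≤ (longCount b p : ℤ) + 5) {v : ℤ}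
    (hv : ((longCount b p : ℤ) + 1) - pairFloors b p ≤ v) :
    dOf b / (p : ℤ) - pairFloors b p - min (if 2 ≤ dOf b / (p : ℤ) then (1 : ℤ) else 0) (5 - (cStar b p : ℤ)) ≤ v := by
  rw [hfd, if_neg (by norm_num)]
  have hmin : -(longCount b p : ℤ) ≤ min (0 : ℤ) (5 - (cStar b p : ℤ)) := le_min (neg_nonpos.2 (by positivity)) (by linarith)
  linarith

end Summit.KontsevichZagierPeriods.Zeta5Search.DenomLaw.FirstPeriodKit
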